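import Literature.AlgebraicGeometry.Motives.MumfordTateGroupPointsDirectProduct
import Literature.AlgebraicGeometry.HodgeTheory.BettiHodgeGroupKernelMultiplierCharacterSign
import HarnessLib

/-!
# `[Ker ν : Hg(Hᵏ(X))] = 2`, `MT(Hᵏ(X))(ℝ) ∩ Z(C_ℝ) ≅ ℝ^× × (Hg ∩ Z(C_ℝ))` and `MT(Hᵏ(X))(L) ≅ L^× × Hg(Hᵏ(X))(L)` for an EVEN degree `k` in which
# `X` carries a non-zero Hodge class, or has odd Betti number `b_k`; the sign lemma on the `ℚ`-points of `MT(Hᵏ(X))`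
# (Green–Griffiths–Kerr §I.B p. 35, §V Warning p. 154; Carlson–Müller-Stach–Peters 15.2 Remark (ii); Moonen (4.4), (5.8); Voisin 7.1.2)

Family `hodge`, lane `lit-hodgefound` (Track 2 foundations library; Layers A2/A3/A4), layer `Literature/AlgebraicGeometry/HodgeTheory`.  THEOREMS ONLY (no definition,
no named fact, no instance; D-0026 net debt `0`).  The Betti TRANSPORT of the seat's `Motives/MumfordTateGroupPointsDirectProduct` (g23-#4) to the tree's
`Hᵏ(X) = BettiUniverse.hodge hHD hX k` (sequel of g23-#3 `HodgeTheory/BettiHodgeGroupKernelMultiplierCharacterSign`): in an even degree `k = 2p` in which `X` has a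
non-zero rational Hodge class `v ∈ Hdgᵖ(Hᵏ(X)) = H^{p,p} ∩ Hᵏ(X(ℂ); ℚ)` (e.g. the class of an algebraic cycle), or in which the Betti number `b_k = dim_ℚ Hᵏ(X; ℚ)`
is odd, the homothety `−1 · id` is NOT in `Hg(Hᵏ(X))` (p02's `Motives/HodgeGroupMinusIdentityOddTensors`), which decides the dichotomies of g23-#1/#2/#3.

THE PRINTS.  As in g23-#4: [GreenGriffithsKerr2012] §I.B p0035 «`M_φ̃` is the semi-direct product of its subgroups `M_φ` and `𝔾_{m,ℚ}`», §V p0154 «Warning … a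
nontrivial sub-Hodge structure of pure type `(n/2, n/2)`»; [CarlsonMullerStachPeters2017] §15.2 Remark (ii) p0368, Examples 15.2.4 p0369, Lemma 15.2.8 (ii) p0370;
[Moonen2004MT] (4.4), (5.8); [VoisinHodgeI2002] §7.1.2 / Thm. 6.32 (polarizability of `Hᵏ(X)`, the tree's `BettiUniverse.hodge_isPolarizable`).

WHAT IS PROVED (`X` smooth projective, `Hᵏ(X) ≠ 0`).
* §1 `ℚ`-points, every `k`: `mem_or_neg_mem_hodgeGroup_hodge_of_multiplierCharRat_eq_one` (`g ∈ MT(Hᵏ(X))(ℚ)`, `ν_ℚ(g) = 1 ⟹ g ∈ Hg ∨ −g ∈ Hg`),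
  `multiplierCharRat_hodge_eq_one_iff_mem_or_neg_mem`.
* §2 `k ≠ 0` with a non-zero Hodge class `v ∈ Hdgᵖ(Hᵏ(X))`, `p + p = k`: **`relIndex_hodgeGroupBaseChange_hodge_ker_multiplierChar_eq_two_of_mem_hodgeClasses`**
  (`[Ker ν : Hg(Hᵏ(X))(L)] = 2`, every field `L`), **`nonempty_inf_centralizer_hodge_mulEquiv_units_prod_of_mem_hodgeClasses`** (`MT(ℝ) ∩ Z(C_ℝ) ≃* ℝ^× × (Hg(ℝ) ∩ Z(C_ℝ))`),
  `existsUnique_smulOfUnit_mul_mem_hodgeGroupBaseChange_hodge_real_of_comm_of_mem_hodgeClasses`,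
  **`nonempty_mumfordTateGroupBaseChange_hodge_mulEquiv_units_prod_of_isAlgClosed_of_mem_hodgeClasses`** (`MT(Hᵏ(X))(L) ≃* L^× × Hg(Hᵏ(X))(L)`, `L` alg. closed).
* §3 `k ≠ 0` with `b_k` odd: `relIndex_hodgeGroupBaseChange_hodge_ker_multiplierChar_eq_two_of_odd_finrank`, `nonempty_inf_centralizer_hodge_mulEquiv_units_prod_of_odd_finrank`,
  `nonempty_mumfordTateGroupBaseChange_hodge_mulEquiv_units_prod_of_isAlgClosed_of_odd_finrank`.

DEVIATIONS / SCOPE.  On points, Tannaka-free.  That `H^{2p}(X)` (`p ≤ dim X`) always has a non-zero Hodge class (the power `Lᵖ` of a hyperplane class) is NOT used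
or proved here; the Hodge class is a hypothesis.

## References
* [GreenGriffithsKerr2012] M. Green, P. A. Griffiths, M. Kerr, *Mumford–Tate Groups and Domains* (2012) — §I.B p. 35, §V Warning p. 154.
* [CarlsonMullerStachPeters2017] J. Carlson, S. Müller-Stach, C. Peters, *Period Mappings and Period Domains*, 2nd ed. (2017) — §15.2 Remark (ii) (p. 368), Examples
  15.2.4 (p. 369), Lemma 15.2.8 (ii) (p. 370).
* [Moonen2004MT] B. Moonen, *An introduction to Mumford–Tate groups* (2004) — (4.4), (4.8), (5.8).
* [VoisinHodgeI2002] C. Voisin, *Hodge Theory and Complex Algebraic Geometry I* (2002) — §7.1.2, Thm. 6.32.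

## Provenance
Lane `lit-hodgefound` (Hodge path, Track 2), prover seat `lit-hodgefound-p29` (generation 23), self-proposed row g23-#5 (Betti sequel of g23-#4).
-/

noncomputable section

open scoped TensorProduct
open CategoryTheory Module

namespace Literature.AlgebraicGeometry.HodgeTheory

open Literature.AlgebraicGeometry.Motives
open Literature.AlgebraicGeometry.Motives.HodgeStructure

universe w

section SmoothProjective

variable [HodgeTensorFacts.{0, 0}] {n : ℕ} {X : SchemeOver ℂ} {k : ℕ} [Module.Finite ℚ (bettiCohomology X k)]

/-! ### §1 `ℚ`-points of `MT(Hᵏ(X))`: the sign lemma -/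

/-- **`g ∈ MT(Hᵏ(X))(ℚ)`, `ν_ℚ(g) = 1 ⟹ g ∈ Hg(Hᵏ(X))(ℚ)` or `−g ∈ Hg(Hᵏ(X))(ℚ)`**, every degree `k`, every polarization `ψ` of `Hᵏ(X)`.
[cite: Moonen2004MT, (5.8)] [cite: CarlsonMullerStachPeters2017, §15.2 Remark (ii) after Definition 15.2.1 (p. 368) and Lemma 15.2.8 (p. 370)] -/
theorem mem_or_neg_mem_hodgeGroup_hodge_of_multiplierCharRat_eq_one [Nontrivial (bettiCohomology X k)] (hHD : exists_isReal_hodgeModel)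
    (hX : IsSmoothProjective n X) (ψ : (BettiUniverse.hodge hHD hX k).Polarization) (g : (BettiUniverse.hodge hHD hX k).mumfordTateGroup)
    (hν : ψ.multiplierCharRat g = 1) :
    (g : bettiCohomology X k ≃ₗ[ℚ] bettiCohomology X k) ∈ (BettiUniverse.hodge hHD hX k).hodgeGroup ∨
      LinearEquiv.smulOfUnit (-1) * (g : bettiCohomology X k ≃ₗ[ℚ] bettiCohomology X k) ∈ (BettiUniverse.hodge hHD hX k).hodgeGroup :=
  ψ.mem_or_neg_mem_hodgeGroup_of_multiplierCharRat_eq_one g hν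

/-- **`ν_ℚ(g) = 1 ⟺ g ∈ Hg(Hᵏ(X))(ℚ) ∨ −g ∈ Hg(Hᵏ(X))(ℚ)`** on `MT(Hᵏ(X))(ℚ)`, every `k`. [cite: Moonen2004MT, (5.8)] [cite: Moonen1999MTNotes, (1.7)] -/
theorem multiplierCharRat_hodge_eq_one_iff_mem_or_neg_mem [Nontrivial (bettiCohomology X k)] (hHD : exists_isReal_hodgeModel)
    (hX : IsSmoothProjective n X) (ψ : (BettiUniverse.hodge hHD hX k).Polarization) (g : (BettiUniverse.hodge hHD hX k).mumfordTateGroup) :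
    ψ.multiplierCharRat g = 1 ↔
      (g : bettiCohomology X k ≃ₗ[ℚ] bettiCohomology X k) ∈ (BettiUniverse.hodge hHD hX k).hodgeGroup ∨
        LinearEquiv.smulOfUnit (-1) * (g : bettiCohomology X k ≃ₗ[ℚ] bettiCohomology X k) ∈ (BettiUniverse.hodge hHD hX k).hodgeGroup :=
  ψ.multiplierCharRat_eq_one_iff_mem_or_neg_mem g

/-! ### §2 A degree `k ≠ 0` carrying a non-zero Hodge class -/

/-- **`[Ker ν : Hg(Hᵏ(X))(L)] = 2`** when `Hᵏ(X)` carries a non-zero rational Hodge class `v ∈ Hdgᵖ(Hᵏ(X))`, `p + p = k ≠ 0` (every field `L ⊇ ℚ`, every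
polarization `ψ`): `−1 · id ∉ Hg` (p02) decides g23-#3's `∣ 2`. [cite: GreenGriffithsKerr2012, §V Warning p. 154] [cite: Moonen2004MT, (4.4) and (5.8)]
[cite: CarlsonMullerStachPeters2017, §15.2 Remark (ii) after Definition 15.2.1 (p. 368)] -/
theorem relIndex_hodgeGroupBaseChange_hodge_ker_multiplierChar_eq_two_of_mem_hodgeClasses [Nontrivial (bettiCohomology X k)]
    (hHD : exists_isReal_hodgeModel) (hX : IsSmoothProjective n X) (hk : k ≠ 0) (L : Type w) [Field L] [Algebra ℚ L]
    (ψ : (BettiUniverse.hodge hHD hX k).Polarization) {p : ℤ} (hp : p + p = (k : ℤ)) {v : bettiCohomology X k}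
    (hv : v ∈ (BettiUniverse.hodge hHD hX k).hodgeClasses p) (hv0 : v ≠ 0) :
    (((BettiUniverse.hodge hHD hX k).hodgeGroupBaseChange L).subgroupOf
        ((BettiUniverse.hodge hHD hX k).mumfordTateGroupBaseChange L)).relIndex (ψ.multiplierChar L).ker = 2 :=
  ψ.relIndex_hodgeGroupBaseChange_ker_multiplierChar_eq_two_of_mem_hodgeClasses _ L (Int.natCast_ne_zero.2 hk) hp hv hv0

/-- **`MT(Hᵏ(X))(ℝ) ∩ Z(C_ℝ) ≃* ℝ^× × (Hg(Hᵏ(X))(ℝ) ∩ Z(C_ℝ))`** when `Hᵏ(X)` carries a non-zero Hodge class `v ∈ Hdgᵖ`, `p + p = k ≠ 0`.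
[cite: GreenGriffithsKerr2012, §I.B p. 35 (semi-direct product remark) and §V Warning p. 154] [cite: CarlsonMullerStachPeters2017, §15.2 Remark (ii) after Definition 15.2.1 (p. 368)]
[cite: VoisinHodgeI2002, §7.1.2 and Thm. 6.32] -/
theorem nonempty_inf_centralizer_hodge_mulEquiv_units_prod_of_mem_hodgeClasses [Nontrivial (bettiCohomology X k)] (hHD : exists_isReal_hodgeModel)
    (hX : IsSmoothProjective n X) (hk : k ≠ 0) {p : ℤ} (hp : p + p = (k : ℤ)) {v : bettiCohomology X k}
    (hv : v ∈ (BettiUniverse.hodge hHD hX k).hodgeClasses p) (hv0 : v ≠ 0) :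
    Nonempty (↥((BettiUniverse.hodge hHD hX k).mumfordTateGroupBaseChange ℝ ⊓
        Subgroup.centralizer {(BettiUniverse.hodge hHD hX k).realWeilOperator}) ≃*
      ℝˣ × ↥((BettiUniverse.hodge hHD hX k).hodgeGroupBaseChange ℝ ⊓ Subgroup.centralizer {(BettiUniverse.hodge hHD hX k).realWeilOperator})) :=
  nonempty_inf_centralizer_mulEquiv_units_prod_of_mem_hodgeClasses _ (Int.natCast_ne_zero.2 hk) (BettiUniverse.hodge_isPolarizable hHD hX k) hp hv hv0

/-- **The real scalar is unique**: for `γ ∈ MT(Hᵏ(X))(ℝ)` commuting with `C_ℝ`, exactly one `c ∈ ℝ^×` has `(c · id) γ ∈ Hg(Hᵏ(X))(ℝ)` (a non-zero Hodge class in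
`Hdgᵖ(Hᵏ(X))`, `p + p = k`, given). [cite: GreenGriffithsKerr2012, §I.B p. 35 (semi-direct product remark) and §V Warning p. 154]
[cite: CarlsonMullerStachPeters2017, §15.2 Examples 15.2.4] -/
theorem existsUnique_smulOfUnit_mul_mem_hodgeGroupBaseChange_hodge_real_of_comm_of_mem_hodgeClasses [Nontrivial (bettiCohomology X k)]
    (hHD : exists_isReal_hodgeModel) (hX : IsSmoothProjective n X) (ψ : (BettiUniverse.hodge hHD hX k).Polarization) {p : ℤ}
    (hp : p + p = (k : ℤ)) {v : bettiCohomology X k} (hv : v ∈ (BettiUniverse.hodge hHD hX k).hodgeClasses p) (hv0 : v ≠ 0)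
    {γ : (ℝ ⊗[ℚ] bettiCohomology X k) ≃ₗ[ℝ] (ℝ ⊗[ℚ] bettiCohomology X k)}
    (hγ : γ ∈ (BettiUniverse.hodge hHD hX k).mumfordTateGroupBaseChange ℝ)
    (hC : ∀ a, γ ((BettiUniverse.hodge hHD hX k).realWeilOperator a) = (BettiUniverse.hodge hHD hX k).realWeilOperator (γ a)) :
    ∃! c : ℝˣ, LinearEquiv.smulOfUnit c * γ ∈ (BettiUniverse.hodge hHD hX k).hodgeGroupBaseChange ℝ :=
  ψ.existsUnique_smulOfUnit_mul_mem_hodgeGroupBaseChange_real_of_comm_of_mem_hodgeClasses _ hp hv hv0 hγ hC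

/-- **`MT(Hᵏ(X))(L) ≃* L^× × Hg(Hᵏ(X))(L)` over an algebraically closed `L`** (`k ≠ 0`, a non-zero Hodge class `v ∈ Hdgᵖ(Hᵏ(X))`, `p + p = k`): on points,
GGK's semi-direct product «of `M_φ` and `𝔾_{m,ℚ}`» is direct. [cite: GreenGriffithsKerr2012, §I.B p. 35 (semi-direct product remark) and §V Warning p. 154]
[cite: CarlsonMullerStachPeters2017, §15.2 Remark (ii) after Definition 15.2.1 (p. 368)] [cite: Moonen2004MT, (4.4) and (4.8)] -/
theorem nonempty_mumfordTateGroupBaseChange_hodge_mulEquiv_units_prod_of_isAlgClosed_of_mem_hodgeClasses [Nontrivial (bettiCohomology X k)]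
    (hHD : exists_isReal_hodgeModel) (hX : IsSmoothProjective n X) (hk : k ≠ 0) (L : Type w) [Field L] [Algebra ℚ L] [IsAlgClosed L]
    (ψ : (BettiUniverse.hodge hHD hX k).Polarization) {p : ℤ} (hp : p + p = (k : ℤ)) {v : bettiCohomology X k}
    (hv : v ∈ (BettiUniverse.hodge hHD hX k).hodgeClasses p) (hv0 : v ≠ 0) :
    Nonempty ((BettiUniverse.hodge hHD hX k).mumfordTateGroupBaseChange L ≃* Lˣ × (BettiUniverse.hodge hHD hX k).hodgeGroupBaseChange L) :=
  ψ.nonempty_mumfordTateGroupBaseChange_mulEquiv_units_prod_of_isAlgClosed_of_mem_hodgeClasses _ L (Int.natCast_ne_zero.2 hk) hp hv hv0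

/-! ### §3 A degree `k ≠ 0` with odd Betti number `b_k` -/

/-- **`b_k` odd ⟹ `[Ker ν : Hg(Hᵏ(X))(L)] = 2`** (`k ≠ 0`, every field `L`, every polarization `ψ`): `det(−1 · id) = −1` excludes `−1 · id` from `Hg ⊂ SL` (p02).
[cite: CarlsonMullerStachPeters2017, §15.2 Def. 15.2.1 (ii) footnote and Remark (ii) (p. 368)] [cite: Moonen2004MT, (5.8)] -/
theorem relIndex_hodgeGroupBaseChange_hodge_ker_multiplierChar_eq_two_of_odd_finrank [Nontrivial (bettiCohomology X k)]
    (hHD : exists_isReal_hodgeModel) (hX : IsSmoothProjective n X) (hk : k ≠ 0) (L : Type w) [Field L] [Algebra ℚ L]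
    (ψ : (BettiUniverse.hodge hHD hX k).Polarization) (hb : Odd (Module.finrank ℚ (bettiCohomology X k))) :
    (((BettiUniverse.hodge hHD hX k).hodgeGroupBaseChange L).subgroupOf
        ((BettiUniverse.hodge hHD hX k).mumfordTateGroupBaseChange L)).relIndex (ψ.multiplierChar L).ker = 2 :=
  ψ.relIndex_hodgeGroupBaseChange_ker_multiplierChar_eq_two_of_odd_finrank _ L (Int.natCast_ne_zero.2 hk) hb

/-- **`b_k` odd ⟹ `MT(Hᵏ(X))(ℝ) ∩ Z(C_ℝ) ≃* ℝ^× × (Hg(Hᵏ(X))(ℝ) ∩ Z(C_ℝ))`** (`k ≠ 0`). [cite: GreenGriffithsKerr2012, §I.B p. 35 (semi-direct product remark)]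
[cite: CarlsonMullerStachPeters2017, §15.2 Def. 15.2.1 (ii) footnote and Remark (ii) (p. 368)] [cite: VoisinHodgeI2002, §7.1.2 and Thm. 6.32] -/
theorem nonempty_inf_centralizer_hodge_mulEquiv_units_prod_of_odd_finrank [Nontrivial (bettiCohomology X k)] (hHD : exists_isReal_hodgeModel)
    (hX : IsSmoothProjective n X) (hk : k ≠ 0) (hb : Odd (Module.finrank ℚ (bettiCohomology X k))) :
    Nonempty (↥((BettiUniverse.hodge hHD hX k).mumfordTateGroupBaseChange ℝ ⊓
        Subgroup.centralizer {(BettiUniverse.hodge hHD hX k).realWeilOperator}) ≃*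
      ℝˣ × ↥((BettiUniverse.hodge hHD hX k).hodgeGroupBaseChange ℝ ⊓ Subgroup.centralizer {(BettiUniverse.hodge hHD hX k).realWeilOperator})) :=
  nonempty_inf_centralizer_mulEquiv_units_prod_of_odd_finrank _ (Int.natCast_ne_zero.2 hk) (BettiUniverse.hodge_isPolarizable hHD hX k) hb

/-- **`b_k` odd ⟹ `MT(Hᵏ(X))(L) ≃* L^× × Hg(Hᵏ(X))(L)` over an algebraically closed `L`** (`k ≠ 0`, `ψ` a polarization).
[cite: GreenGriffithsKerr2012, §I.B p. 35 (semi-direct product remark)] [cite: CarlsonMullerStachPeters2017, §15.2 Def. 15.2.1 (ii) footnote and Remark (ii) (p. 368)] -/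
theorem nonempty_mumfordTateGroupBaseChange_hodge_mulEquiv_units_prod_of_isAlgClosed_of_odd_finrank [Nontrivial (bettiCohomology X k)]
    (hHD : exists_isReal_hodgeModel) (hX : IsSmoothProjective n X) (hk : k ≠ 0) (L : Type w) [Field L] [Algebra ℚ L] [IsAlgClosed L]
    (ψ : (BettiUniverse.hodge hHD hX k).Polarization) (hb : Odd (Module.finrank ℚ (bettiCohomology X k))) :
    Nonempty ((BettiUniverse.hodge hHD hX k).mumfordTateGroupBaseChange L ≃* Lˣ × (BettiUniverse.hodge hHD hX k).hodgeGroupBaseChange L) :=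
  ψ.nonempty_mumfordTateGroupBaseChange_mulEquiv_units_prod_of_isAlgClosed_of_odd_finrank _ L (Int.natCast_ne_zero.2 hk) hb

end SmoothProjective

end Literature.AlgebraicGeometry.HodgeTheory

end
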